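import Summits.QuantumFields.BalabanUV.Beta.D1BFx.RoadEndBFxRecutTailsSbpS
import Summits.QuantumFields.BalabanUV.Beta.D1BFx.RoadEndBFxD1SumS

/-!
# `BalabanUV.Beta.D1BFx.RoadEndBFxRecutSpineDictS` — road «BF-x» for binder row D1, PER-WORD lane: THE SPINE JUNCTION AND THE (K) SLOT AS ONE DICTIONARY ROW
# for the per-word END above the summation-by-parts wall — `D1Sum`∕`D1Tel` + `hdict` ⊢ `D1Drift`, and PER-WORD ROAD ⟹ the spine's `D1Rep`

HONEST DEPENDENCY (page 1, mandatory): continuum YM on T⁴ ⇐ BetaPertH ∧ nine spine estimates (0/9 proved); BetaPertH ⇐ (D1) ∧ (D4) ∧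
CAP+tail; G-an2-4 gates asym, D1 and NE2/3/4.  HONEST FRAMING (cell contract, verbatim): «discharging `BetaPertH` makes Bałaban's UV
stability UNCONDITIONAL — a real constructive-QFT result; it is NOT the continuum limit and NOT the Clay problem.»  THIS MODULE DISCHARGES
NOTHING of the wall: [folklore] composition BY NAME of the per-word END `RoadEndBFxRecutTailsSbpS.d1Drift_BFx_recut_sbp_of_prop12S` (p303072) with the
Literature's read-out seam (`StepDriftWitness.D1Sum`, `d1Sum_of_d1Tel`, `d1Rep_iff_d1Drift_of_d1Sum`) and the owner's junction pieces
`RoadEndBFxD1SumS.hB1_of_D1Sum_hKshot` ∕ `window_id` (p298645), the (K) letter `c` instantiated by the road's per-word formula exactly as in the owner's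
«END-SBP-DICT» `RoadEndBFxSpineDictS` (p305244).  No `def`, no `Prop` mirror, no cited fact, 0 sorry.  0 root-level binders discharged
(hW ∕ hR-sockets ∕ hSX-socket ∕ D1Tel ∕ D1Rep = 0); NOT (K), NOT D1, NOT `BetaPertH`, NOT continuum, NOT Clay.

ABSOLUTE RULE (cell charter, verbatim): «No internally-minted statement may enter as a cited fact. Every hypothesis is either kernel-proved in
this package or a verbatim quotation of a PUBLISHED theorem with page reference. The manuscript(s) under audit are NOT citable for their own
disputed steps — they are the thing under adjudication; programme-internal (2001/route/tribunal) claims are never citable.»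

WHY (owner d1-p2 gen 13, `OWNER-MEMO-g13.md` §1(A)+§2 item 1b; `LEAVES-BFx.md` rows «END-SBP-JCT» ∕ «END-SBP-DICT»).  The per-word END of the road,
`RoadEndBFxRecutTailsSbpS.d1Drift_BFx_recut_sbp_of_prop12S`, displays the bridge `hB1` (the telescoped sum of the step kernels' second moments against a
free letter `c`) and the (K) row `hK` (the road's per-word formula for `c n`, odd `n ≥ 2`).  As on the owner's total lane («END-SBP-JCT» `RoadEndBFxSpineSbpS` →
«END-SBP-DICT» `RoadEndBFxSpineDictS`) and on the mean lane (`RoadEndBFxSpineDictMeanS`, leaf-01), the bridge IS the spine's telescoping binder (`D1Sum`, or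
`hW`∕`hRfl`∕`D1Tel`) composed with a one-shot estimate, and the letter `c` is then pinned by `hK` at every scale that is read — so the per-word END's (K) debt is
ONE displayed row `hdict`: at each one-shot scale `n = Lc^m`, `m ≥ 1`, the (1.22) second moment of the spine's one-shot kernel `TshotOf Lc Jc m` is within `U₁` of
the per-word road formula (Feynman-gauge gluon term over the re-cut table + complete ghost term + rest words) AT THAT SCALE.  Given `D1Sum`, the Literature's
`D1Rep ⟺ D1Drift` turns the per-word END into a SUPPLIER of the spine root's representation binder `D1Rep Lc Jc N μ ν a SL k`.

CONTENT.
* §1 [folklore] **`d1Drift_BFx_recut_of_D1Sum_dict_sbpS`** — `d1Drift_BFx_recut_sbp_of_prop12S` with `c`, `hB1`, `hK` REPLACED by `Jc`, `hsum : D1Sum Lc Js Jc μ ν`, `hdict`; every other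
  binder VERBATIM, same order (`h12`∕`h126` (printed statements, BY NAME), `s`∕`hωs`∕`hlam`, the five slot-table sockets + covariance + bond swap, `hdiv`, `hrowgh`, (REST′) off the corner, (U)) ⊢ `D1Drift Lc Js N μ ν` — NO leg row, no letter `c`.
* §2 [folklore] **`d1Rep_BFx_recut_of_D1Sum_dict_sbpS`** — §1's list + labels `hSL`, `k` ⊢ `D1Rep Lc Jc N μ ν a SL k` (via `StepDriftWitness.d1Rep_iff_d1Drift_of_d1Sum`, window data `window_id`).
* §3 [folklore] **`d1Rep_BFx_recut_of_D1Tel_dict_sbpS`** — §2 with `hsum` SUPPLIED by `StepDriftWitness.d1Sum_of_d1Tel` from `hW`∕`hRfl`∕`htel : D1Tel Lc Js Jc` (the spine root's own binder names).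
Unit `b2b-balaban-beta-d1-formalise-leaf-04` (gen 16), D1 formalisation swarm, per-word lane; journal INTENT [D1LEAF04-G16-INTENT-1]; `LEAVES-BFx.md` row «END-SBP-WORD-DICT».
-/

noncomputable section

open Finset Filter Topology
open scoped BigOperators
open Literature.MathematicalPhysics.QuantumFieldTheory.Balaban1983to89
open Literature.MathematicalPhysics.QuantumFieldTheory.Balaban1983to89.Beta
open OneStepResolventKernel (JetData)
open OneStepKernelFamily (TbalOf TshotOf flipK D1Tel D1Rep D1Drift)
open PolarizationSign (WardTransversal AxisReflectionCovariant)
open StepDriftWitness (D1Sum d1Sum_of_d1Tel d1Rep_iff_d1Drift_of_d1Sum)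
open WindowIdentification (fullSum)
open DyadicShell (Pt supNorm)
open ExpKernelCalculus (Site BiLoc shiftK)
open BubbleTransfer (unitVec)
open DressedMomentNormalisation (resSite)
open VectorTailsLoc (fam kfam)
open Summit.QuantumFields.BalabanUV.Beta.TameKernelCalculus (Spr)
open Summit.QuantumFields.BalabanUV.Beta.D1BFx.GluonLeg (Ga)
open Summit.QuantumFields.BalabanUV.Beta.D1BFx.ReducedKernel (TableR TOfRed)
open Summit.QuantumFields.BalabanUV.Beta.D1BFx.DressedTadpoleTable (tableRed)
open Summit.QuantumFields.BalabanUV.Beta.D1BFx.ReducedKernelSandwich (fineHess)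
open Summit.QuantumFields.BalabanUV.Beta.D1BFx.FineStencilBFBalaban (SbfBal)
open Summit.QuantumFields.BalabanUV.Beta.D1BFx.SecondStencilBF (Wbf)
open Summit.QuantumFields.BalabanUV.Beta.D1BFx.GhostKernelComplete (PghQ fineHessGhQ)
open Summit.QuantumFields.BalabanUV.Beta.D1BFx.FrozenLegProfile (gfrz)
open Summit.QuantumFields.BalabanUV.Beta.D1BFx.SplitInstance (RestIdx)
open Summit.QuantumFields.BalabanUV.Beta.D1BFx.SplitInstanceS (restKS)
open Summit.QuantumFields.BalabanUV.Beta.D1BFx.RoadEndBFxRecut (cornerIdx)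
open Summit.QuantumFields.BalabanUV.Beta.D1BFx.RoadEndBFxRecutTailsSbpS (d1Drift_BFx_recut_sbp_of_prop12S d1Drift_BFx_recut_ray_sbp_of_prop12S)
open Summit.QuantumFields.BalabanUV.Beta.D1BFx.RoadEndBFxD1SumS (hB1_of_D1Sum_hKshot window_id)
open Summit.QuantumFields.BalabanUV.Beta.D1BFx.FrozenLegTails (nOf MOf hn1)

namespace Summit.QuantumFields.BalabanUV.Beta.D1BFx.RoadEndBFxRecutSpineDictS

variable {Lc : ℕ} [NeZero Lc] {a N : ℝ} {μ ν : Fin 4} {υ : Type*} [Fintype υ]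
  {cE cVH cΛ cR cK cQ cgh cE₂ cJ4 cΛ₂ cR₂ cQ₂ x₀ ωgl ωgh : ℕ → ℝ} {WE WJ WΛ WR WQ : ℕ → TableR} {CE CJ CΛ CRt CQ δW : ℕ → ℝ}
  {Ru : υ → ℕ → ℝ} {CU : υ → ℝ} {CR : RestIdx → ℝ} {U₁ : ℝ}

/-! ## §1 `D1Drift` over `D1Sum` + the dictionary row (per-word END) -/

/-- [folklore] **ROAD BF-x, PER-WORD END OVER `D1Sum` WITH THE (K) SLOT FUSED INTO ONE DICTIONARY ROW.**
`RoadEndBFxRecutTailsSbpS.d1Drift_BFx_recut_sbp_of_prop12S` (p303072) with the free letter `c : ℕ → ℝ`, the bridge `hB1` and the (K) row `hK` REPLACED by: composite jet data `Jc`,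
the Literature's `hsum : D1Sum Lc Js Jc μ ν` and the single row `hdict` (the (A1)–(A3) dictionary at the one-shot scales `n = Lc^m`, a HYPOTHESIS).  Proof: the owner's device of
`RoadEndBFxSpineDictS` — `c` := the per-word road formula (`0` at `n = 0`, never read), `hK` by `dif_neg`, `hKshot` from `hdict`, `hB1` by `RoadEndBFxD1SumS.hB1_of_D1Sum_hKshot`.
Every other binder BYTE-IDENTICAL to the per-word END (`h12`∕`h126` (printed statements, BY NAME), `s`∕`hωs`∕`hlam`, the five slot-table sockets + covariance + bond swap, `hdiv`, `hrowgh`, (REST′) off the corner, (U)).  HONEST: composition BY NAME; every binder a HYPOTHESIS;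
0 root-level binders discharged; (K) NOT closed; NOT D1, NOT `BetaPertH`, NOT continuum, NOT Clay. -/
theorem d1Drift_BFx_recut_of_D1Sum_dict_sbpS (Js : ℕ → JetData 3 Lc) (hμν : μ ≠ ν) (hN : N ≠ 0) (hL : 2 ≤ Lc) (hodd : Odd Lc) (ha : 0 < a)
    -- the two PRINTED statements, by name, for the family scale × even cubic volumes
    (h12 : B5.Prop12Printed (fam nOf hn1 MOf a ha)) (h126 : B5.Kernel126_127Printed (kfam nOf MOf))
    -- bridge B1 REPLACED: composite jet data + the telescoping binder; then the ONE dictionary row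
    (Jc : ∀ m : ℕ, JetData 3 (Lc ^ m)) (hsum : D1Sum Lc Js Jc μ ν)
    -- the (K) slot AS ONE DICTIONARY ROW at the one-shot scales `n = Lc^m` (the (A1)–(A3) dictionary, a HYPOTHESIS)
    (hdict : ∀ m : ℕ, 1 ≤ m → |B12Beta.secondMoment (TshotOf Lc Jc m) μ ν -
      (ωgl (Lc ^ m) * B12Beta.secondMoment (TOfRed (Lc ^ m) a (SbfBal (Lc ^ m) a (cE (Lc ^ m)) (cVH (Lc ^ m)) (cΛ (Lc ^ m)) (cR (Lc ^ m)) (cK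
          (Lc ^ m)) (cQ (Lc ^ m))) (tableRed (Lc ^ m) (Wbf (cE₂ (Lc ^ m)) (cJ4 (Lc ^ m)) (cΛ₂ (Lc ^ m)) (cR₂ (Lc ^ m)) (cQ₂ (Lc ^ m)) (WE (Lc ^ m))
          (WJ (Lc ^ m)) (WΛ (Lc ^ m)) (WR (Lc ^ m)) (WQ (Lc ^ m))))) μ ν + ωgh (Lc ^ m) * B12Beta.secondMoment (PghQ (Lc ^ m) a (x₀ (Lc ^ m)) (cK
          (Lc ^ m)) (cQ (Lc ^ m))) μ ν + ∑ u, Ru u (Lc ^ m))| ≤ U₁)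
    (s : ℕ → ℝ) (hωs : ∀ n : ℕ, 2 ≤ n → ωgh n * (s n * cK n) ^ 2 = -2 * (ωgl n * cE n ^ 2))
    (hlam : ∀ n : ℕ, 2 ≤ n → ωgl n * cE n ^ 2 = 2 * N ^ 2 * (n : ℝ) ^ 8)
    -- slot-table sockets
    (hδW : ∀ n, 0 < δW n)
    (hE : ∀ n κ u l u', BiLoc (WE n κ u l u') u u' (CE n) (δW n)) (hJ : ∀ n κ u l u', BiLoc (WJ n κ u l u') u u' (CJ n) (δW n))
    (hΛ : ∀ n κ u l u', BiLoc (WΛ n κ u l u') u u' (CΛ n) (δW n)) (hR : ∀ n κ u l u', BiLoc (WR n κ u l u') u u' (CRt n) (δW n))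
    (hQ : ∀ n κ u l u', BiLoc (WQ n κ u l u') u u' (CQ n) (δW n))
    (hEc : ∀ (n : ℕ) (κ : Fin 4) (u : Site 4) (l : Fin 4) (u' t : Site 4),
      WE n κ (u + (n : ℤ) • t) l (u' + (n : ℤ) • t) = shiftK (-((n : ℤ) • t)) (WE n κ u l u'))
    (hJc : ∀ (n : ℕ) (κ : Fin 4) (u : Site 4) (l : Fin 4) (u' t : Site 4),
      WJ n κ (u + (n : ℤ) • t) l (u' + (n : ℤ) • t) = shiftK (-((n : ℤ) • t)) (WJ n κ u l u'))
    (hΛc : ∀ (n : ℕ) (κ : Fin 4) (u : Site 4) (l : Fin 4) (u' t : Site 4),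
      WΛ n κ (u + (n : ℤ) • t) l (u' + (n : ℤ) • t) = shiftK (-((n : ℤ) • t)) (WΛ n κ u l u'))
    (hRc : ∀ (n : ℕ) (κ : Fin 4) (u : Site 4) (l : Fin 4) (u' t : Site 4),
      WR n κ (u + (n : ℤ) • t) l (u' + (n : ℤ) • t) = shiftK (-((n : ℤ) • t)) (WR n κ u l u'))
    (hQc : ∀ (n : ℕ) (κ : Fin 4) (u : Site 4) (l : Fin 4) (u' t : Site 4),
      WQ n κ (u + (n : ℤ) • t) l (u' + (n : ℤ) • t) = shiftK (-((n : ℤ) • t)) (WQ n κ u l u'))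
    (hEs : ∀ n κ u l u', WE n κ u l u' = WE n l u' κ u) (hJs : ∀ n κ u l u', WJ n κ u l u' = WJ n l u' κ u)
    (hΛs : ∀ n κ u l u', WΛ n κ u l u' = WΛ n l u' κ u) (hRs : ∀ n κ u l u', WR n κ u l u' = WR n l u' κ u)
    (hQs : ∀ n κ u l u', WQ n κ u l u' = WQ n l u' κ u)
    -- first-bond divergence-freeness of the gluon fine Hessian kernel; the ghost Ward rows
    (hdiv : ∀ n : ℕ, 2 ≤ n → ∀ [NeZero n], ∀ (l' : Fin 4) (u' u : Site 4), ∑ κ' : Fin 4,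
      (fineHess n a (SbfBal n a (cE n) (cVH n) (cΛ n) (cR n) (cK n) (cQ n))
          (Wbf (cE₂ n) (cJ4 n) (cΛ₂ n) (cR₂ n) (cQ₂ n) (WE n) (WJ n) (WΛ n) (WR n) (WQ n)) κ' l' (u - Pi.single κ' 1) u'
        - fineHess n a (SbfBal n a (cE n) (cVH n) (cΛ n) (cR n) (cK n) (cQ n))
          (Wbf (cE₂ n) (cJ4 n) (cΛ₂ n) (cR₂ n) (cQ₂ n) (WE n) (WJ n) (WΛ n) (WR n) (WQ n)) κ' l' u u') = 0)
    (hrowgh : ∀ n : ℕ, 2 ≤ n → ∀ [NeZero n], ∀ (κ' l' : Fin 4) (b : Site 4), HasSum (fineHessGhQ n a (x₀ n) (cK n) (cQ n) κ' l' b) 0)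
    -- (REST′) for the re-cut words other than the corner, n-UNIFORM; (U)
    (hRest : ∀ n : ℕ, 2 ≤ n → ∀ [NeZero n], ∀ τ : RestIdx, τ ≠ cornerIdx →
      |∑ b ∈ (univ : Finset (Fin 4 → Fin n)).image resSite, ((n : ℝ) ^ 4)⁻¹ *
        fullSum (fun w : Pt => restKS n a (gfrz n a b) (fun v => s n * gfrz n a b v) (cE n) (cΛ n) (cR n) (cK n) (cQ n) (cE₂ n) (cJ4 n) (cΛ₂ n) (cR₂ n) (cQ₂ n) (x₀ n)
          (WE n) (WJ n) (WΛ n) (WR n) (WQ n) (ωgl n) (ωgh n) ((n : ℝ) ^ 8) N μ ν b τ w)| ≤ CR τ)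
    (hU : ∀ n : ℕ, 2 ≤ n → ∀ u, |Ru u n| ≤ CU u) :
    D1Drift Lc Js N μ ν := by
  classical
  -- the (K) letter `c` IS the road's per-word formula (odd scales only are ever read; `0` at `n = 0`)
  let c : ℕ → ℝ := fun n => if hn : n = 0 then 0 else
    haveI : NeZero n := ⟨hn⟩
    ωgl n * B12Beta.secondMoment (TOfRed n a (SbfBal n a (cE n) (cVH n) (cΛ n) (cR n) (cK n) (cQ n))
      (tableRed n (Wbf (cE₂ n) (cJ4 n) (cΛ₂ n) (cR₂ n) (cQ₂ n) (WE n) (WJ n) (WΛ n) (WR n) (WQ n)))) μ ν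
      + ωgh n * B12Beta.secondMoment (PghQ n a (x₀ n) (cK n) (cQ n)) μ ν + ∑ u, Ru u n
  have hK : ∀ n : ℕ, 2 ≤ n → Odd n → ∀ [NeZero n], c n =
      ωgl n * B12Beta.secondMoment (TOfRed n a (SbfBal n a (cE n) (cVH n) (cΛ n) (cR n) (cK n) (cQ n))
      (tableRed n (Wbf (cE₂ n) (cJ4 n) (cΛ₂ n) (cR₂ n) (cQ₂ n) (WE n) (WJ n) (WΛ n) (WR n) (WQ n)))) μ ν
      + ωgh n * B12Beta.secondMoment (PghQ n a (x₀ n) (cK n) (cQ n)) μ ν + ∑ u, Ru u n := by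
    intro n hn _ _
    simp only [c, dif_neg (show n ≠ 0 by omega)]
  have hKshot : ∀ m : ℕ, 1 ≤ m → |B12Beta.secondMoment (TshotOf Lc Jc m) μ ν - c (Lc ^ m)| ≤ U₁ := by
    intro m hm
    simp only [c, dif_neg (pow_ne_zero m (NeZero.ne Lc))]
    exact hdict m hm
  exact d1Drift_BFx_recut_sbp_of_prop12S
    Js hμν hN hL hodd ha c h12 h126 (hB1_of_D1Sum_hKshot Js Jc c hsum hKshot) hK s hωs hlam hδW hE hJ hΛ hR hQ hEc hJc hΛc hRc hQc hEs hJs hΛs hRs hQs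
    hdiv hrowgh hRest hU

/-! ## §2–§3 The per-word road SUPPLIES the spine's `D1Rep` over the dictionary row -/

/-- [folklore] **PER-WORD ROAD BF-x ⟹ THE SPINE's `D1Rep`, DICTIONARY FORM.**  From EXACTLY the displayed list of §1 plus base-point labels
`hSL : SL.Nonempty`, `k : L → Fin 4`: the spine root's representation binder `D1Rep Lc Jc N μ ν a SL k`.  Proof: §1 gives `D1Drift Lc Js N μ ν`; the Literature's
`D1Rep ⟺ D1Drift` GIVEN `D1Sum` (`StepDriftWitness.d1Rep_iff_d1Drift_of_d1Sum`, i.e. the free-bubble drift under `h12`∕`h126`), window data `RoadEndBFxD1SumS.window_id`.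
HONEST: as §1. -/
theorem d1Rep_BFx_recut_of_D1Sum_dict_sbpS (Js : ℕ → JetData 3 Lc) (hμν : μ ≠ ν) (hN : N ≠ 0) (hL : 2 ≤ Lc) (hodd : Odd Lc) (ha : 0 < a)
    -- the two PRINTED statements, by name, for the family scale × even cubic volumes
    (h12 : B5.Prop12Printed (fam nOf hn1 MOf a ha)) (h126 : B5.Kernel126_127Printed (kfam nOf MOf))
    -- bridge B1 REPLACED: composite jet data + the telescoping binder; then the ONE dictionary row
    (Jc : ∀ m : ℕ, JetData 3 (Lc ^ m)) (hsum : D1Sum Lc Js Jc μ ν)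
    -- the (K) slot AS ONE DICTIONARY ROW at the one-shot scales `n = Lc^m` (the (A1)–(A3) dictionary, a HYPOTHESIS)
    (hdict : ∀ m : ℕ, 1 ≤ m → |B12Beta.secondMoment (TshotOf Lc Jc m) μ ν -
      (ωgl (Lc ^ m) * B12Beta.secondMoment (TOfRed (Lc ^ m) a (SbfBal (Lc ^ m) a (cE (Lc ^ m)) (cVH (Lc ^ m)) (cΛ (Lc ^ m)) (cR (Lc ^ m)) (cK
          (Lc ^ m)) (cQ (Lc ^ m))) (tableRed (Lc ^ m) (Wbf (cE₂ (Lc ^ m)) (cJ4 (Lc ^ m)) (cΛ₂ (Lc ^ m)) (cR₂ (Lc ^ m)) (cQ₂ (Lc ^ m)) (WE (Lc ^ m))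
          (WJ (Lc ^ m)) (WΛ (Lc ^ m)) (WR (Lc ^ m)) (WQ (Lc ^ m))))) μ ν + ωgh (Lc ^ m) * B12Beta.secondMoment (PghQ (Lc ^ m) a (x₀ (Lc ^ m)) (cK
          (Lc ^ m)) (cQ (Lc ^ m))) μ ν + ∑ u, Ru u (Lc ^ m))| ≤ U₁)
    (s : ℕ → ℝ) (hωs : ∀ n : ℕ, 2 ≤ n → ωgh n * (s n * cK n) ^ 2 = -2 * (ωgl n * cE n ^ 2))
    (hlam : ∀ n : ℕ, 2 ≤ n → ωgl n * cE n ^ 2 = 2 * N ^ 2 * (n : ℝ) ^ 8)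
    -- slot-table sockets
    (hδW : ∀ n, 0 < δW n)
    (hE : ∀ n κ u l u', BiLoc (WE n κ u l u') u u' (CE n) (δW n)) (hJ : ∀ n κ u l u', BiLoc (WJ n κ u l u') u u' (CJ n) (δW n))
    (hΛ : ∀ n κ u l u', BiLoc (WΛ n κ u l u') u u' (CΛ n) (δW n)) (hR : ∀ n κ u l u', BiLoc (WR n κ u l u') u u' (CRt n) (δW n))
    (hQ : ∀ n κ u l u', BiLoc (WQ n κ u l u') u u' (CQ n) (δW n))
    (hEc : ∀ (n : ℕ) (κ : Fin 4) (u : Site 4) (l : Fin 4) (u' t : Site 4),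
      WE n κ (u + (n : ℤ) • t) l (u' + (n : ℤ) • t) = shiftK (-((n : ℤ) • t)) (WE n κ u l u'))
    (hJc : ∀ (n : ℕ) (κ : Fin 4) (u : Site 4) (l : Fin 4) (u' t : Site 4),
      WJ n κ (u + (n : ℤ) • t) l (u' + (n : ℤ) • t) = shiftK (-((n : ℤ) • t)) (WJ n κ u l u'))
    (hΛc : ∀ (n : ℕ) (κ : Fin 4) (u : Site 4) (l : Fin 4) (u' t : Site 4),
      WΛ n κ (u + (n : ℤ) • t) l (u' + (n : ℤ) • t) = shiftK (-((n : ℤ) • t)) (WΛ n κ u l u'))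
    (hRc : ∀ (n : ℕ) (κ : Fin 4) (u : Site 4) (l : Fin 4) (u' t : Site 4),
      WR n κ (u + (n : ℤ) • t) l (u' + (n : ℤ) • t) = shiftK (-((n : ℤ) • t)) (WR n κ u l u'))
    (hQc : ∀ (n : ℕ) (κ : Fin 4) (u : Site 4) (l : Fin 4) (u' t : Site 4),
      WQ n κ (u + (n : ℤ) • t) l (u' + (n : ℤ) • t) = shiftK (-((n : ℤ) • t)) (WQ n κ u l u'))
    (hEs : ∀ n κ u l u', WE n κ u l u' = WE n l u' κ u) (hJs : ∀ n κ u l u', WJ n κ u l u' = WJ n l u' κ u)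
    (hΛs : ∀ n κ u l u', WΛ n κ u l u' = WΛ n l u' κ u) (hRs : ∀ n κ u l u', WR n κ u l u' = WR n l u' κ u)
    (hQs : ∀ n κ u l u', WQ n κ u l u' = WQ n l u' κ u)
    -- first-bond divergence-freeness of the gluon fine Hessian kernel; the ghost Ward rows
    (hdiv : ∀ n : ℕ, 2 ≤ n → ∀ [NeZero n], ∀ (l' : Fin 4) (u' u : Site 4), ∑ κ' : Fin 4,
      (fineHess n a (SbfBal n a (cE n) (cVH n) (cΛ n) (cR n) (cK n) (cQ n))
          (Wbf (cE₂ n) (cJ4 n) (cΛ₂ n) (cR₂ n) (cQ₂ n) (WE n) (WJ n) (WΛ n) (WR n) (WQ n)) κ' l' (u - Pi.single κ' 1) u'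
        - fineHess n a (SbfBal n a (cE n) (cVH n) (cΛ n) (cR n) (cK n) (cQ n))
          (Wbf (cE₂ n) (cJ4 n) (cΛ₂ n) (cR₂ n) (cQ₂ n) (WE n) (WJ n) (WΛ n) (WR n) (WQ n)) κ' l' u u') = 0)
    (hrowgh : ∀ n : ℕ, 2 ≤ n → ∀ [NeZero n], ∀ (κ' l' : Fin 4) (b : Site 4), HasSum (fineHessGhQ n a (x₀ n) (cK n) (cQ n) κ' l' b) 0)
    -- (REST′) for the re-cut words other than the corner, n-UNIFORM; (U)
    (hRest : ∀ n : ℕ, 2 ≤ n → ∀ [NeZero n], ∀ τ : RestIdx, τ ≠ cornerIdx →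
      |∑ b ∈ (univ : Finset (Fin 4 → Fin n)).image resSite, ((n : ℝ) ^ 4)⁻¹ *
        fullSum (fun w : Pt => restKS n a (gfrz n a b) (fun v => s n * gfrz n a b v) (cE n) (cΛ n) (cR n) (cK n) (cQ n) (cE₂ n) (cJ4 n) (cΛ₂ n) (cR₂ n) (cQ₂ n) (x₀ n)
          (WE n) (WJ n) (WΛ n) (WR n) (WQ n) (ωgl n) (ωgh n) ((n : ℝ) ^ 8) N μ ν b τ w)| ≤ CR τ)
    (hU : ∀ n : ℕ, 2 ≤ n → ∀ u, |Ru u n| ≤ CU u)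
    -- base-point labels of the free one-shot side (the spine root's `hSL` ∕ `k`); the Literature's window data is discharged at `M := id`, `cc := 1`
    {L : Type*} {SL : Finset L} (hSL : SL.Nonempty) (k : L → Fin 4) :
    D1Rep Lc Jc N μ ν a SL k :=
  (d1Rep_iff_d1Drift_of_d1Sum a ha h12 h126 hSL k hμν hN hL Js Jc hsum window_id.1 window_id.2.1 window_id.2.2).2
    (d1Drift_BFx_recut_of_D1Sum_dict_sbpS
      Js hμν hN hL hodd ha h12 h126 Jc hsum hdict s hωs hlam hδW hE hJ hΛ hR hQ hEc hJc hΛc hRc hQc hEs hJs hΛs hRs hQs hdiv hrowgh hRest hU)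

/-- [folklore] **PER-WORD ROAD BF-x ⟹ THE SPINE's `D1Rep` AT THE SPINE ROOT's OWN BINDER NAMES, DICTIONARY FORM**: §2 with `hsum` SUPPLIED by
`StepDriftWitness.d1Sum_of_d1Tel` from the printed symmetries `hW`∕`hRfl` of the flipped step kernels and the spine's `htel : D1Tel Lc Js Jc` (literally the
binders of `OneStepKernelFamily.d1Drift_of_D1Tel_D1Rep`).  HONEST: as §1. -/
theorem d1Rep_BFx_recut_of_D1Tel_dict_sbpS (Js : ℕ → JetData 3 Lc) (hμν : μ ≠ ν) (hN : N ≠ 0) (hL : 2 ≤ Lc) (hodd : Odd Lc) (ha : 0 < a)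
    -- the two PRINTED statements, by name, for the family scale × even cubic volumes
    (h12 : B5.Prop12Printed (fam nOf hn1 MOf a ha)) (h126 : B5.Kernel126_127Printed (kfam nOf MOf))
    -- bridge B1 REPLACED: composite jet data + the telescoping binder; then the ONE dictionary row
    (Jc : ∀ m : ℕ, JetData 3 (Lc ^ m)) 
    (hW : ∀ j, WardTransversal (flipK (TbalOf Lc Js j))) (hRfl : ∀ j, AxisReflectionCovariant (flipK (TbalOf Lc Js j)))
    (htel : D1Tel Lc Js Jc)
    -- the (K) slot AS ONE DICTIONARY ROW at the one-shot scales `n = Lc^m` (the (A1)–(A3) dictionary, a HYPOTHESIS)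
    (hdict : ∀ m : ℕ, 1 ≤ m → |B12Beta.secondMoment (TshotOf Lc Jc m) μ ν -
      (ωgl (Lc ^ m) * B12Beta.secondMoment (TOfRed (Lc ^ m) a (SbfBal (Lc ^ m) a (cE (Lc ^ m)) (cVH (Lc ^ m)) (cΛ (Lc ^ m)) (cR (Lc ^ m)) (cK
          (Lc ^ m)) (cQ (Lc ^ m))) (tableRed (Lc ^ m) (Wbf (cE₂ (Lc ^ m)) (cJ4 (Lc ^ m)) (cΛ₂ (Lc ^ m)) (cR₂ (Lc ^ m)) (cQ₂ (Lc ^ m)) (WE (Lc ^ m))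
          (WJ (Lc ^ m)) (WΛ (Lc ^ m)) (WR (Lc ^ m)) (WQ (Lc ^ m))))) μ ν + ωgh (Lc ^ m) * B12Beta.secondMoment (PghQ (Lc ^ m) a (x₀ (Lc ^ m)) (cK
          (Lc ^ m)) (cQ (Lc ^ m))) μ ν + ∑ u, Ru u (Lc ^ m))| ≤ U₁)
    (s : ℕ → ℝ) (hωs : ∀ n : ℕ, 2 ≤ n → ωgh n * (s n * cK n) ^ 2 = -2 * (ωgl n * cE n ^ 2))
    (hlam : ∀ n : ℕ, 2 ≤ n → ωgl n * cE n ^ 2 = 2 * N ^ 2 * (n : ℝ) ^ 8)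
    -- slot-table sockets
    (hδW : ∀ n, 0 < δW n)
    (hE : ∀ n κ u l u', BiLoc (WE n κ u l u') u u' (CE n) (δW n)) (hJ : ∀ n κ u l u', BiLoc (WJ n κ u l u') u u' (CJ n) (δW n))
    (hΛ : ∀ n κ u l u', BiLoc (WΛ n κ u l u') u u' (CΛ n) (δW n)) (hR : ∀ n κ u l u', BiLoc (WR n κ u l u') u u' (CRt n) (δW n))
    (hQ : ∀ n κ u l u', BiLoc (WQ n κ u l u') u u' (CQ n) (δW n))
    (hEc : ∀ (n : ℕ) (κ : Fin 4) (u : Site 4) (l : Fin 4) (u' t : Site 4),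
      WE n κ (u + (n : ℤ) • t) l (u' + (n : ℤ) • t) = shiftK (-((n : ℤ) • t)) (WE n κ u l u'))
    (hJc : ∀ (n : ℕ) (κ : Fin 4) (u : Site 4) (l : Fin 4) (u' t : Site 4),
      WJ n κ (u + (n : ℤ) • t) l (u' + (n : ℤ) • t) = shiftK (-((n : ℤ) • t)) (WJ n κ u l u'))
    (hΛc : ∀ (n : ℕ) (κ : Fin 4) (u : Site 4) (l : Fin 4) (u' t : Site 4),
      WΛ n κ (u + (n : ℤ) • t) l (u' + (n : ℤ) • t) = shiftK (-((n : ℤ) • t)) (WΛ n κ u l u'))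
    (hRc : ∀ (n : ℕ) (κ : Fin 4) (u : Site 4) (l : Fin 4) (u' t : Site 4),
      WR n κ (u + (n : ℤ) • t) l (u' + (n : ℤ) • t) = shiftK (-((n : ℤ) • t)) (WR n κ u l u'))
    (hQc : ∀ (n : ℕ) (κ : Fin 4) (u : Site 4) (l : Fin 4) (u' t : Site 4),
      WQ n κ (u + (n : ℤ) • t) l (u' + (n : ℤ) • t) = shiftK (-((n : ℤ) • t)) (WQ n κ u l u'))
    (hEs : ∀ n κ u l u', WE n κ u l u' = WE n l u' κ u) (hJs : ∀ n κ u l u', WJ n κ u l u' = WJ n l u' κ u)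
    (hΛs : ∀ n κ u l u', WΛ n κ u l u' = WΛ n l u' κ u) (hRs : ∀ n κ u l u', WR n κ u l u' = WR n l u' κ u)
    (hQs : ∀ n κ u l u', WQ n κ u l u' = WQ n l u' κ u)
    -- first-bond divergence-freeness of the gluon fine Hessian kernel; the ghost Ward rows
    (hdiv : ∀ n : ℕ, 2 ≤ n → ∀ [NeZero n], ∀ (l' : Fin 4) (u' u : Site 4), ∑ κ' : Fin 4,
      (fineHess n a (SbfBal n a (cE n) (cVH n) (cΛ n) (cR n) (cK n) (cQ n))
          (Wbf (cE₂ n) (cJ4 n) (cΛ₂ n) (cR₂ n) (cQ₂ n) (WE n) (WJ n) (WΛ n) (WR n) (WQ n)) κ' l' (u - Pi.single κ' 1) u'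
        - fineHess n a (SbfBal n a (cE n) (cVH n) (cΛ n) (cR n) (cK n) (cQ n))
          (Wbf (cE₂ n) (cJ4 n) (cΛ₂ n) (cR₂ n) (cQ₂ n) (WE n) (WJ n) (WΛ n) (WR n) (WQ n)) κ' l' u u') = 0)
    (hrowgh : ∀ n : ℕ, 2 ≤ n → ∀ [NeZero n], ∀ (κ' l' : Fin 4) (b : Site 4), HasSum (fineHessGhQ n a (x₀ n) (cK n) (cQ n) κ' l' b) 0)
    -- (REST′) for the re-cut words other than the corner, n-UNIFORM; (U)
    (hRest : ∀ n : ℕ, 2 ≤ n → ∀ [NeZero n], ∀ τ : RestIdx, τ ≠ cornerIdx →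
      |∑ b ∈ (univ : Finset (Fin 4 → Fin n)).image resSite, ((n : ℝ) ^ 4)⁻¹ *
        fullSum (fun w : Pt => restKS n a (gfrz n a b) (fun v => s n * gfrz n a b v) (cE n) (cΛ n) (cR n) (cK n) (cQ n) (cE₂ n) (cJ4 n) (cΛ₂ n) (cR₂ n) (cQ₂ n) (x₀ n)
          (WE n) (WJ n) (WΛ n) (WR n) (WQ n) (ωgl n) (ωgh n) ((n : ℝ) ^ 8) N μ ν b τ w)| ≤ CR τ)
    (hU : ∀ n : ℕ, 2 ≤ n → ∀ u, |Ru u n| ≤ CU u)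
    -- base-point labels of the free one-shot side (the spine root's `hSL` ∕ `k`); the Literature's window data is discharged at `M := id`, `cc := 1`
    {L : Type*} {SL : Finset L} (hSL : SL.Nonempty) (k : L → Fin 4) :
    D1Rep Lc Jc N μ ν a SL k :=
  d1Rep_BFx_recut_of_D1Sum_dict_sbpS
    Js hμν hN hL hodd ha h12 h126 Jc (d1Sum_of_d1Tel Js Jc hW hRfl htel μ ν) hdict s hωs hlam hδW hE hJ hΛ hR hQ hEc hJc hΛc hRc hQc hEs hJs hΛs hRs
    hQs hdiv hrowgh hRest hU hSL k

end Summit.QuantumFields.BalabanUV.Beta.D1BFx.RoadEndBFxRecutSpineDictS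

end
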